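import Literature.Topology.FourManifolds.HeightTwoCriticalBall
import HarnessLib

/-!
# Side functions: properness on the positive side; two defining functions of one hypersurface

Topic `Literature/Topology/FourManifolds`; tools for the fact seat of Alexander's theorem
(`provefact-Literature.Topology.FourManifolds.SphereEmbedding.schoenflies_exists_ball`, Schultens
(2014), Thm. 3.2.5).  **Everything in this file is proved; no definitions, no named facts.**

* §1 `SideComparison.exists_properPos` — a smooth `F` with compact `{F ≤ 0}` can be modified
  off a ball containing `{F ≤ 0}` into a smooth `F'` with the same signs everywhere, equal to
  `F` on the ball, and with `{F' ≤ ε}` compact for some `ε > 0` (the compactness hypothesis of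
  the fact seat's configurations).
* §2 `SideComparison.exists_fderiv_eq_smul` — two functions vanishing on an immersed
  hypersurface, both regular at a point of it, have proportional differentials there;
  `SideComparison.eventually_sign_iff` — **if moreover they have the same zero set near the
  point and the factor is positive, their signs agree near the point** (both are strictly
  increasing along nearby lines in a transverse direction and vanish at the same parameter).

## References
* J. M. Lee, *Introduction to Smooth Manifolds*, 2nd ed., Springer GTM 218 (2013), Ch. 5
  (regular level sets, defining functions).
* J. Schultens, *Introduction to 3-Manifolds*, GSM 151, AMS (2014), Thm. 3.2.5.
-/

open scoped RealInnerProductSpace Topology Manifold ContDiff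
open Set Filter Metric Function

noncomputable section

namespace Literature.Topology.FourManifolds

namespace SideComparison

variable {E : Type*} [NormedAddCommGroup E] [InnerProductSpace ℝ E] [FiniteDimensional ℝ E]

/-! ### §1 Making a side function proper on the positive side -/

/-- **Properness on the positive side.**  A smooth `F` with compact `{F ≤ 0}` can be modified off
a ball containing `{F ≤ 0}` into a smooth `F'` with the same sign everywhere (so the same zero
set and sides), equal to `F` on that ball, and with compact `{F' ≤ ε}` for some `ε > 0`
(`F' = (1 - χ) F + χ` with `χ` a cutoff vanishing on the ball and `1` far away). [folklore] -/
theorem exists_properPos [Nontrivial E] {F : E → ℝ} (hF : ContDiff ℝ ∞ F) (hK : IsCompact {x | F x ≤ 0}) :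
    ∃ F' : E → ℝ, ContDiff ℝ ∞ F' ∧ (∃ ε, 0 < ε ∧ IsCompact {x | F' x ≤ ε}) ∧
      (∀ x, F' x < 0 ↔ F x < 0) ∧ (∀ x, F' x = 0 ↔ F x = 0) ∧ (∀ x, 0 < F' x ↔ 0 < F x) ∧
      ∃ R, 0 < R ∧ {x | F x ≤ 0} ⊆ ball 0 R ∧ ∀ x ∈ ball (0 : E) R, F' x = F x := by
  obtain ⟨R₀, hR₀⟩ := hK.isBounded.subset_ball 0
  set R := max R₀ 1 with hR
  have hR0 : 0 < R := lt_of_lt_of_le one_pos (le_max_right _ _)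
  have hKR : {x | F x ≤ 0} ⊆ ball (0 : E) R := hR₀.trans (ball_subset_ball (le_max_left _ _))
  have hFpos : ∀ x, R ≤ ‖x‖ → 0 < F x := by
    intro x hx
    by_contra h
    have : x ∈ ball (0 : E) R := hKR (not_lt.1 h)
    rw [mem_ball_zero_iff] at this
    linarith
  -- positivity constant on the shell `R ≤ ‖x‖ ≤ R + 1`
  obtain ⟨c₁, hc₁, hc₁F⟩ : ∃ c₁, 0 < c₁ ∧ ∀ x, R ≤ ‖x‖ → ‖x‖ ≤ R + 1 → c₁ ≤ F x := by
    set S := {x : E | R ≤ ‖x‖ ∧ ‖x‖ ≤ R + 1} with hS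
    have hSc : IsCompact S := by
      have : S ⊆ closedBall (0 : E) (R + 1) := fun x hx => by
        rw [mem_closedBall, dist_zero_right]; exact hx.2
      exact (isCompact_closedBall (0 : E) (R + 1)).of_isClosed_subset
        ((isClosed_le continuous_const continuous_norm).inter (isClosed_le continuous_norm continuous_const)) this
    rcases S.eq_empty_or_nonempty with hSe | hSne
    · refine ⟨1, one_pos, fun x h1 h2 => ?_⟩
      have : x ∈ S := ⟨h1, h2⟩
      rw [hSe] at this; exact absurd this (notMem_empty x)
    · obtain ⟨x₀, hx₀S, hx₀⟩ := hSc.exists_isMinOn hSne hF.continuous.continuousOn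
      refine ⟨F x₀, hFpos x₀ hx₀S.1, fun x h1 h2 => hx₀ (show x ∈ S from ⟨h1, h2⟩)⟩
  -- the cutoff `χ = ST((‖x‖² - R²)/((R+1)² - R²))`
  set D : ℝ := (R + 1) ^ 2 - R ^ 2 with hD
  have hD0 : 0 < D := by rw [hD]; nlinarith
  set χ : E → ℝ := fun x => Real.smoothTransition ((‖x‖ ^ 2 - R ^ 2) / D) with hχ
  have hχs : ContDiff ℝ ∞ χ :=
    Real.smoothTransition.contDiff.comp (((contDiff_norm_sq ℝ).sub contDiff_const).div_const D)
  have hχ0 : ∀ x, ‖x‖ ≤ R → χ x = 0 := fun x hx =>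
    Real.smoothTransition.zero_of_nonpos (div_nonpos_of_nonpos_of_nonneg (by nlinarith [norm_nonneg x]) hD0.le)
  have hχ1 : ∀ x, R + 1 ≤ ‖x‖ → χ x = 1 := fun x hx =>
    Real.smoothTransition.one_of_one_le ((one_le_div hD0).2 (by rw [hD]; nlinarith [norm_nonneg x]))
  have hχI : ∀ x, 0 ≤ χ x ∧ χ x ≤ 1 := fun x =>
    ⟨Real.smoothTransition.nonneg _, Real.smoothTransition.le_one _⟩
  set F' : E → ℝ := fun x => (1 - χ x) * F x + χ x with hF'
  have hF's : ContDiff ℝ ∞ F' := ((contDiff_const.sub hχs).mul hF).add hχs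
  have hF'eq : ∀ x, ‖x‖ ≤ R → F' x = F x := fun x hx => by
    simp only [hF', hχ0 x hx]; ring
  have hF'pos : ∀ x, R ≤ ‖x‖ → min c₁ 1 ≤ F' x := by
    intro x hx
    obtain ⟨h0, h1⟩ := hχI x
    by_cases hx1 : ‖x‖ ≤ R + 1
    · have hFx := hc₁F x hx hx1
      simp only [hF']
      nlinarith [min_le_left c₁ 1, min_le_right c₁ 1]
    · push Not at hx1
      simp only [hF', hχ1 x hx1.le]
      norm_num
  have hc0 : 0 < min c₁ 1 := lt_min hc₁ one_pos
  -- the signs agree everywhere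
  have hsign : ∀ x, (F' x < 0 ↔ F x < 0) ∧ (F' x = 0 ↔ F x = 0) ∧ (0 < F' x ↔ 0 < F x) := by
    intro x
    by_cases hx : ‖x‖ ≤ R
    · rw [hF'eq x hx]; exact ⟨Iff.rfl, Iff.rfl, Iff.rfl⟩
    · push Not at hx
      have h1 := hF'pos x hx.le
      have h2 := hFpos x hx.le
      refine ⟨⟨fun h => ?_, fun h => ?_⟩, ⟨fun h => ?_, fun h => ?_⟩, ⟨fun _ => h2, fun _ => ?_⟩⟩ <;> linarith
  refine ⟨F', hF's, ⟨min c₁ 1 / 2, by linarith, ?_⟩, fun x => (hsign x).1, fun x => (hsign x).2.1,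
    fun x => (hsign x).2.2, R, hR0, hKR, fun x hx => hF'eq x (le_of_lt (mem_ball_zero_iff.1 hx))⟩
  -- `{F' ≤ ε} ⊆ closedBall 0 R` is compact
  refine (isCompact_closedBall (0 : E) R).of_isClosed_subset (isClosed_le hF's.continuous continuous_const)
    fun x hx => ?_
  rw [mem_closedBall, dist_zero_right]
  by_contra h
  push Not at h
  have := hF'pos x h.le
  simp only [mem_setOf_eq] at hx
  linarith

/-! ### §2 Two defining functions of the same hypersurface -/

variable {m : ℕ} {M : Type*} [TopologicalSpace M] [ChartedSpace (EuclideanSpace ℝ (Fin m)) M]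

/-- **Proportional differentials.**  Two functions vanishing on the image of an immersion of an
`m`-manifold into an `(m+1)`-space, both with nonzero differential at an image point, have
proportional differentials there (both kernels are the tangent space,
`ExpHeight.fderiv_apply_eq_zero_iff_exists_mfderiv_eq`), with a nonzero factor. [folklore] -/
theorem exists_fderiv_eq_smul (hdim : Module.finrank ℝ E = m + 1) {f : M → E} {x : M}
    (hf : MDifferentiableAt (𝓡 m) 𝓘(ℝ, E) f x)
    (hinj : Injective (mfderiv (𝓡 m) 𝓘(ℝ, E) f x)) {F G : E → ℝ}
    (hF : DifferentiableAt ℝ F (f x)) (hFf : ∀ y, F (f y) = 0) (hDF : fderiv ℝ F (f x) ≠ 0)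
    (hG : DifferentiableAt ℝ G (f x)) (hGf : ∀ y, G (f y) = 0) (hDG : fderiv ℝ G (f x) ≠ 0) :
    ∃ μ : ℝ, μ ≠ 0 ∧ fderiv ℝ F (f x) = μ • fderiv ℝ G (f x) := by
  have hker : ∀ w, fderiv ℝ G (f x) w = 0 → fderiv ℝ F (f x) w = 0 := by
    intro w hw
    rw [ExpHeight.fderiv_apply_eq_zero_iff_exists_mfderiv_eq hdim hf hinj hG hGf hDG] at hw
    rw [ExpHeight.fderiv_apply_eq_zero_iff_exists_mfderiv_eq hdim hf hinj hF hFf hDF]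
    exact hw
  obtain ⟨μ, hμ⟩ := ExpHeight.exists_eq_smul_of_forall_eq_zero hDG hker
  refine ⟨μ, fun h0 => hDF ?_, hμ⟩
  rw [hμ, h0, zero_smul]

omit [FiniteDimensional ℝ E] in
/-- **Same sides, locally.**  Let `F, G` be `C¹` near `x`, with the same zero set near `x`,
`G x = 0`, `DG(x) ≠ 0` and `DF(x) = μ DG(x)` with `μ > 0`.  Then near `x` the signs of `F` and
`G` agree.  (Along the lines `t ↦ y + tν`, `DG(x)ν > 0`, both functions are strictly increasing
near `x` and vanish at the same parameter.) [folklore] -/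
theorem eventually_sign_iff {F G : E → ℝ} {x : E} (hF : ContDiff ℝ 1 F) (hG : ContDiff ℝ 1 G)
    (hx : G x = 0) (hZ : ∀ᶠ y in 𝓝 x, F y = 0 ↔ G y = 0) (hDG : fderiv ℝ G x ≠ 0) {μ : ℝ}
    (hμ : 0 < μ) (hD : fderiv ℝ F x = μ • fderiv ℝ G x) :
    ∀ᶠ y in 𝓝 x, (F y < 0 ↔ G y < 0) ∧ (0 < F y ↔ 0 < G y) := by
  -- a direction `ν` with `DG(x)ν = 1`
  obtain ⟨u, hu⟩ : ∃ u, fderiv ℝ G x u ≠ 0 := by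
    by_contra hall; push Not at hall; exact hDG (ContinuousLinearMap.ext hall)
  set ν : E := (fderiv ℝ G x u)⁻¹ • u with hν
  have hνG : fderiv ℝ G x ν = 1 := by rw [hν, map_smul, smul_eq_mul, inv_mul_cancel₀ hu]
  have hνF : fderiv ℝ F x ν = μ := by rw [hD, FunLike.coe_smul, Pi.smul_apply, hνG, smul_eq_mul, mul_one]
  -- continuity of the directional derivatives
  have hGd : Differentiable ℝ G := hG.differentiable (by simp)
  have hFd : Differentiable ℝ F := hF.differentiable (by simp)
  have hcG : Continuous fun y => fderiv ℝ G y ν :=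
    (hG.continuous_fderiv (by simp)).clm_apply continuous_const
  have hcF : Continuous fun y => fderiv ℝ F y ν :=
    (hF.continuous_fderiv (by simp)).clm_apply continuous_const
  -- a ball on which both directional derivatives are positive and the zero sets agree
  obtain ⟨r, hr, hball⟩ : ∃ r > 0, ∀ y ∈ ball x r,
      0 < fderiv ℝ G y ν ∧ 0 < fderiv ℝ F y ν ∧ (F y = 0 ↔ G y = 0) := by
    have h1 : ∀ᶠ y in 𝓝 x, 0 < fderiv ℝ G y ν :=
      hcG.continuousAt.eventually (eventually_gt_nhds (show 0 < fderiv ℝ G x ν by rw [hνG]; exact one_pos))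
    have h2 : ∀ᶠ y in 𝓝 x, 0 < fderiv ℝ F y ν :=
      hcF.continuousAt.eventually (eventually_gt_nhds (show 0 < fderiv ℝ F x ν by rw [hνF]; exact hμ))
    obtain ⟨r, hr, h⟩ := Metric.eventually_nhds_iff_ball.1 (h1.and (h2.and hZ))
    exact ⟨r, hr, fun y hy => ⟨(h y hy).1, (h y hy).2.1, (h y hy).2.2⟩⟩
  -- lines `t ↦ y + tν` with `y ∈ ball x (r/2)`, `|t| ≤ τ`, `τ ‖ν‖ < r/2`, stay in the ball
  have hν0 : 0 < ‖ν‖ := by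
    rw [norm_pos_iff]; intro h0; rw [h0, map_zero] at hνG; exact zero_ne_one hνG
  set τ : ℝ := r / (4 * ‖ν‖) with hτ
  have hτ0 : 0 < τ := div_pos hr (by positivity)
  have hτν : τ * ‖ν‖ = r / 4 := by rw [hτ]; field_simp
  have hline : ∀ y ∈ ball x (r / 2), ∀ t, |t| ≤ τ → y + t • ν ∈ ball x r := by
    intro y hy t ht
    rw [mem_ball] at hy ⊢
    calc dist (y + t • ν) x ≤ dist (y + t • ν) y + dist y x := dist_triangle _ _ _
      _ = ‖t • ν‖ + dist y x := by rw [dist_eq_norm, add_sub_cancel_left]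
      _ = |t| * ‖ν‖ + dist y x := by rw [norm_smul, Real.norm_eq_abs]
      _ < r := by nlinarith [mul_le_mul_of_nonneg_right ht hν0.le]
  -- strict monotonicity of `t ↦ G (y + tν)` and `t ↦ F (y + tν)` on `[-τ, τ]`
  have hderiv : ∀ (H : E → ℝ), Differentiable ℝ H → ∀ y t,
      HasDerivAt (fun t : ℝ => H (y + t • ν)) (fderiv ℝ H (y + t • ν) ν) t := by
    intro H hH y t
    have hl : HasDerivAt (fun t : ℝ => y + t • ν) ν t := by
      simpa using ((hasDerivAt_id t).smul_const ν).const_add y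
    exact (hH (y + t • ν)).hasFDerivAt.comp_hasDerivAt t hl
  have hmono : ∀ (H : E → ℝ), Differentiable ℝ H → (∀ y ∈ ball x r, 0 < fderiv ℝ H y ν) →
      ∀ y ∈ ball x (r / 2), StrictMonoOn (fun t : ℝ => H (y + t • ν)) (Icc (-τ) τ) := by
    intro H hH hpos y hy
    refine strictMonoOn_of_deriv_pos (convex_Icc _ _)
      (fun t _ => (hderiv H hH y t).continuousAt.continuousWithinAt) fun t ht => ?_
    rw [(hderiv H hH y t).deriv]
    rw [interior_Icc] at ht
    exact hpos _ (hline y hy t (abs_le.2 ⟨ht.1.le, ht.2.le⟩))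
  -- at `y = x`: `G(x - τν) < 0 < G(x + τν)`; by continuity the same near `x`
  have hxball : x ∈ ball x (r / 2) := mem_ball_self (by linarith)
  have hGx1 : G (x + τ • ν) > 0 := by
    have := hmono G hGd (fun y hy => (hball y hy).1) x hxball (show (0:ℝ) ∈ Icc (-τ) τ from ⟨by linarith, hτ0.le⟩)
      (show τ ∈ Icc (-τ) τ from ⟨by linarith, le_rfl⟩) hτ0
    simpa [hx] using this
  have hGx2 : G (x + (-τ) • ν) < 0 := by
    have := hmono G hGd (fun y hy => (hball y hy).1) x hxball (show -τ ∈ Icc (-τ) τ from ⟨le_rfl, by linarith⟩)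
      (show (0:ℝ) ∈ Icc (-τ) τ from ⟨by linarith, hτ0.le⟩) (by linarith)
    simpa [hx] using this
  have hev1 : ∀ᶠ y in 𝓝 x, 0 < G (y + τ • ν) :=
    ((hG.continuous.comp (continuous_id.add continuous_const)).continuousAt).eventually (eventually_gt_nhds hGx1)
  have hev2 : ∀ᶠ y in 𝓝 x, G (y + (-τ) • ν) < 0 :=
    ((hG.continuous.comp (continuous_id.add continuous_const)).continuousAt).eventually (eventually_lt_nhds hGx2)
  have hev3 : ∀ᶠ y in 𝓝 x, y ∈ ball x (r / 2) := ball_mem_nhds x (by linarith)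
  filter_upwards [hev1, hev2, hev3] with y hy1 hy2 hy3
  -- the common zero `t₀` on the line through `y`
  have hcont : ContinuousOn (fun t : ℝ => G (y + t • ν)) (Icc (-τ) τ) := fun t _ =>
    (hderiv G hGd y t).continuousAt.continuousWithinAt
  obtain ⟨t₀, ht₀, ht₀G⟩ : ∃ t₀ ∈ Icc (-τ) τ, G (y + t₀ • ν) = 0 := by
    have := intermediate_value_Icc (by linarith : -τ ≤ τ) hcont
    exact this ⟨hy2.le, hy1.le⟩
  have ht₀F : F (y + t₀ • ν) = 0 :=
    ((hball _ (hline y hy3 t₀ (abs_le.2 ⟨ht₀.1, ht₀.2⟩))).2.2).2 ht₀G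
  have hmG := hmono G hGd (fun y hy => (hball y hy).1) y hy3
  have hmF := hmono F hFd (fun y hy => (hball y hy).2.1) y hy3
  have h0 : (0:ℝ) ∈ Icc (-τ) τ := ⟨by linarith, hτ0.le⟩
  -- signs at `t = 0` versus the position of `t₀`
  have key : ∀ (H : E → ℝ), StrictMonoOn (fun t : ℝ => H (y + t • ν)) (Icc (-τ) τ) →
      H (y + t₀ • ν) = 0 → ((H y < 0 ↔ 0 < t₀) ∧ (0 < H y ↔ t₀ < 0)) := by
    intro H hm h0H
    have e0 : (fun t : ℝ => H (y + t • ν)) 0 = H y := by simp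
    have et : (fun t : ℝ => H (y + t • ν)) t₀ = 0 := h0H
    rcases lt_trichotomy t₀ 0 with hlt | heq | hgt
    · have h1 : (fun t : ℝ => H (y + t • ν)) t₀ < (fun t : ℝ => H (y + t • ν)) 0 := hm ht₀ h0 hlt
      rw [e0, et] at h1
      exact ⟨⟨fun h => absurd h1 (by linarith), fun h => absurd hlt (by linarith)⟩,
        ⟨fun _ => hlt, fun _ => h1⟩⟩
    · subst heq
      have : H y = 0 := e0.symm.trans et
      exact ⟨⟨fun h => absurd this (by linarith), fun h => absurd h (lt_irrefl _)⟩,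
        ⟨fun h => absurd this (by linarith), fun h => absurd h (lt_irrefl _)⟩⟩
    · have h1 : (fun t : ℝ => H (y + t • ν)) 0 < (fun t : ℝ => H (y + t • ν)) t₀ := hm h0 ht₀ hgt
      rw [e0, et] at h1
      exact ⟨⟨fun _ => hgt, fun _ => h1⟩,
        ⟨fun h => absurd h1 (by linarith), fun h => absurd hgt (by linarith)⟩⟩
  obtain ⟨kF1, kF2⟩ := key F hmF ht₀F
  obtain ⟨kG1, kG2⟩ := key G hmG ht₀G
  exact ⟨kF1.trans kG1.symm, kF2.trans kG2.symm⟩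

end SideComparison

end Literature.Topology.FourManifolds

end
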